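import Literature.AlgebraicGeometry.HodgeTheory.FiniteMonodromyOfFlatPolarization
import Literature.AlgebraicGeometry.HodgeTheory.BettiUniverseEigenspacePieces
import Literature.AlgebraicGeometry.HodgeTheory.MonodromySemisimpleSubvariations
import Literature.AlgebraicGeometry.HodgeTheory.HodgeGenericQbarDescentProofs
import Literature.AlgebraicGeometry.HodgeTheory.QbarFamilyLocalSystem
import Literature.AlgebraicGeometry.HodgeTheory.HodgeFiltrationModelsReductionProofs
import Literature.AlgebraicGeometry.HodgeTheory.ComplexConjugationHolds
import Literature.AlgebraicGeometry.HodgeTheory.FibrewiseDeckRelations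
import Summits.HodgeConjecture.HodgeConjecture.Theorems.Q8SymplecticPowersTransportRestriction
import HarnessLib

/-!
# Route `Q8SymplecticPowers`, crux K1Q «mechanism-v5» — glue S7, brick G4 (FIN₊): the `τ²`-INVARIANT part of `H²(X_t; ℚ)`
# consists of Hodge classes (S4 (o)) and therefore of classes with a FINITE monodromy orbit

Support file for crux K1Q (stmt-HodgeConjecture-24190; `--supports … --as helper`; nothing here closes an item). Prover seat
`hodge-nonav-19716-p2` (g14), owner of stub S7 `stub_transportHeredityQ`. This is hypothesis (hV) `ker(A² − 1) ≤ N` of the restriction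
currency `mem_glIdentityComponent_of_variablePart` (`Q8SymplecticPowersTransportRestrictionCurrency`), in the POINT CURRENCY of S4 ∕ S5 ∕ S7:

* `eigenspace_one_le_hodgeClasses_one` — for a smooth projective `X` and a Hodge endomorphism `a ∈ End_Hdg H²(X; ℚ)` whose complexified
  `1`-eigenspace meets `H^{2,0}` trivially, the rational `1`-eigenspace of `a` consists of Hodge classes (the eigenspace is the direct sum
  of its Hodge blocks, `HodgeStructure.mem_iSup_eigenspace_inf_piece`; the `(0,2)`-block is conjugate to the `(2,0)`-block,
  `finrank_eigenspace_inf_piece_eq`; the other blocks lie in `F¹`).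
* **`eigenspace_sq_le_span_finiteIndexFixed`** — for a smooth projective family of surfaces `π : 𝒳 ⟶ S` with `𝒳`, `S` quasi-projective,
  `S` smooth of pure dimension, an endomorphism `τ` over `S`, a point `t` at which S4 (o) holds (`ker((τ_t^*)² ⊗ ℂ − 1) ∩ H^{2,0} = 0`)
  and whose monodromy commutes with `τ_t^*` (brick G1): `ker((τ_t^*)² − 1) ≤ N := span {x | some finite-index Γ' ≤ Γ_t fixes x}`.
  PROOF: every monodromy translate of `x ∈ ker((τ_t^*)² − 1)` stays there (G1), hence is a rational `(1,1)`-class (first bullet +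
  `HodgeModel.isOfHodgeType_of_mem_hodgeClasses`); Deligne's move (F) `exists_finiteIndex_of_isOfHodgeType` (finite monodromy on the
  rational `(1,1)`-classes of a projective family, PROVED in the tree) gives a finite-index `H ≤ π₁(S(ℂ), t)` fixing `x ⊗ 1`; its image
  under the monodromy representation `ratMonodromyRep` (rational transports exist by Ehresmann, `isRationalClass_transportFun_univ`) is a
  finite-index `Γ' ≤ Γ_t` fixing `x`.

HONEST FRAMING: assembly of tree theorems (axioms standard, no named fact); K1Q ∕ HC ∕ HC_AV NOT proved; item 24190 OPEN.

## References
* [Deligne1982HodgeCycles] P. Deligne, Hodge cycles on abelian varieties, LNM 900 (1982), proof of Thm. 2.15 (move (F)).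
* [vanGeemen2008RealMultK3] B. van Geemen, Real multiplication on K3 surfaces and Kuga–Satake varieties, Michigan Math. J. 56 (2008), §2.
* [VoisinHodgeII2003] C. Voisin, Hodge Theory and Complex Algebraic Geometry II, CUP 2003, §3.1.2.
-/

noncomputable section

set_option linter.dupNamespace false

namespace Summit.HodgeConjecture.HodgeConjecture.Theorems.Q8SymplecticPowersInvariantPartFiniteOrbit

open CategoryTheory CategoryTheory.Limits AlgebraicGeometry
open Literature.AlgebraicGeometry.Motives Literature.AlgebraicGeometry.HodgeTheory
open Literature.AlgebraicGeometry.HodgeTheory.BettiUniverse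
open Literature.AlgebraicTopology.SingularHomology
open Summit.HodgeConjecture.HodgeConjecture.Theorems.Q8SymplecticPowersTransportRestriction (apply_mem_eigenspace_of_comm)
open scoped TensorProduct

/-! ### §1 A Hodge endomorphism's `1`-eigenspace with no `(2,0)`-part consists of Hodge classes -/

/-- **`ker(a − 1) ≤ Hdg¹` when `ker(a_ℂ − 1) ∩ H^{2,0} = 0`**, for `a ∈ End_Hdg H²(X; ℚ)` on a smooth projective `X`: the complexified
eigenspace is the direct sum of its Hodge blocks `ker(a_ℂ − 1) ∩ H^{p,2−p}`; the `(2,0)`-block vanishes by hypothesis, the `(0,2)`-block is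
its complex conjugate (`1` is real), the blocks with `p ≥ 1` lie in `F¹`, and the blocks off `0 ≤ p ≤ 2` vanish.
[cite: vanGeemen2008RealMultK3, §2] -/
theorem eigenspace_one_le_hodgeClasses_one {n : ℕ} {X : SchemeOver ℂ} (hX : IsSmoothProjective n X)
    {a : Module.End ℚ (bettiCohomology X 2)} (ha : a ∈ (hodge exists_isReal_hodgeModel_holds hX 2).endAlg)
    (h20 : Module.finrank ℂ ↥(Module.End.eigenspace (a.baseChange ℂ) 1 ⊓ (hodge exists_isReal_hodgeModel_holds hX 2).piece 2 0) = 0) :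
    Module.End.eigenspace a 1 ≤ (hodge exists_isReal_hodgeModel_holds hX 2).hodgeClasses 1 := by
  haveI := finite hX 2
  set H := hodge exists_isReal_hodgeModel_holds hX 2 with hH
  intro v hv
  rw [HodgeStructure.mem_hodgeClasses_iff]
  -- `1 ⊗ v` is a `1`-eigenvector of `a_ℂ`
  have hx : HodgeStructure.ofRat v ∈ Module.End.eigenspace (a.baseChange ℂ) (1 : ℂ) := by
    rw [Module.End.mem_eigenspace_iff, one_smul, HodgeStructure.ofRat_apply, LinearMap.baseChange_tmul]
    have hv' := Module.End.mem_eigenspace_iff.1 hv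
    rw [one_smul] at hv'
    rw [hv']
  have hmem := HodgeStructure.mem_iSup_eigenspace_inf_piece H ⟨a, ha⟩ (μ := (1 : ℂ)) hx
  -- every Hodge block of the eigenspace lies in `F¹`
  have hle : (⨆ p : ℤ, Module.End.eigenspace (a.baseChange ℂ) (1 : ℂ) ⊓ H.piece p (((2 : ℕ) : ℤ) - p)) ≤ H.F 1 := by
    refine iSup_le fun p => ?_
    by_cases hp1 : 1 ≤ p
    · exact inf_le_right.trans ((H.piece_le_F p _).trans (H.antitone_F hp1))
    by_cases hp0 : p = 0
    · subst hp0
      -- the `(0,2)`-block is conjugate to the `(2,0)`-block, which vanishes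
      have h02 : Module.finrank ℂ ↥(Module.End.eigenspace (a.baseChange ℂ) (1 : ℂ) ⊓ H.piece 0 2) = 0 := by
        rw [HodgeStructure.finrank_eigenspace_inf_piece_eq H a (1 : ℂ) 0 2, map_one]
        exact h20
      have hbot : Module.End.eigenspace (a.baseChange ℂ) (1 : ℂ) ⊓ H.piece 0 2 = ⊥ := Submodule.finrank_eq_zero.mp h02
      have h2 : ((2 : ℕ) : ℤ) - 0 = 2 := by norm_num
      rw [h2, hbot]
      exact bot_le
    · -- `p < 0`: the piece `H^{p, 2−p}` vanishes (`2 − p > 2`)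
      have hp : p < 0 := by omega
      rw [hodge_piece_eq_bot_of_lt_right exists_isReal_hodgeModel_holds hX 2 (by push_cast; omega), inf_bot_eq]
      exact bot_le
  exact hle hmem

/-! ### §2 FIN₊: the `τ²`-invariant part has finite monodromy orbits -/

/-- **FIN₊ (hypothesis (hV) of the restriction currency).** `π : 𝒳 ⟶ S` a smooth projective family of surfaces with `𝒳`, `S`
quasi-projective and `S` smooth of pure dimension `d`, cohomologically locally trivial over `S(ℂ)` (`hU`); `τ` an endomorphism of `𝒳` over `S`;
`t ∈ S(ℂ)` with `A := τ_t^*` on `H²(X_t; ℚ)`; hypotheses: the monodromy group `Γ_t` commutes with `A` (brick G1) and S4 (o)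
`dim (ker(A² ⊗ ℂ − 1) ∩ H^{2,0}(X_t)) = 0`. Then `ker(A² − 1)` is contained in the span `N` of the classes fixed by a finite-index subgroup
of `Γ_t` (registered text). [cite: Deligne1982HodgeCycles, proof of Thm. 2.15 (move (F))] [cite: VoisinHodgeII2003, §3.1.2] -/
theorem eigenspace_sq_le_span_finiteIndexFixed {𝒳 S : SchemeOver ℂ} (π : 𝒳 ⟶ S) (hπ : IsSmoothProjectiveFamily π 2)
    (h𝒳 : IsQuasiProjectiveOver 𝒳) (hS : IsQuasiProjectiveOver S) (d : ℕ) [SmoothOfRelativeDimension d S.hom]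
    (hU : IsCohomologicallyLocallyTrivialOn π (Set.univ : Set (ComplexPoints S))) (τ : 𝒳 ⟶ 𝒳) (hτ : τ ≫ π = π)
    (t : ComplexPoints S)
    (hΓA : ∀ γ ∈ ratMonodromyGroup π 2 hU ⟨t, Set.mem_univ t⟩, ∀ x,
      γ (pull (fiberOverEnd π τ hτ t) 2 x) = pull (fiberOverEnd π τ hτ t) 2 (γ x))
    (h20 : Module.finrank ℂ ↥(Module.End.eigenspace ((pull (fiberOverEnd π τ hτ t) 2 ^ 2).baseChange ℂ) 1 ⊓
      (hodge exists_isReal_hodgeModel_holds (hπ.isSmoothProjective t) 2).piece 2 0) = 0) :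
    Module.End.eigenspace (pull (fiberOverEnd π τ hτ t) 2 ^ 2) 1 ≤
      Submodule.span ℚ {x : bettiCohomology (fiberOver π t) 2 |
        ∃ Γ' : Subgroup (bettiCohomology (fiberOver π t) 2 ≃ₗ[ℚ] bettiCohomology (fiberOver π t) 2),
          Γ' ≤ ratMonodromyGroup π 2 hU ⟨t, Set.mem_univ t⟩ ∧
          (Γ'.subgroupOf (ratMonodromyGroup π 2 hU ⟨t, Set.mem_univ t⟩)).FiniteIndex ∧ ∀ γ ∈ Γ', γ x = x} := by
  classical
  intro v hv
  refine Submodule.subset_span ?_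
  have hXt : IsSmoothProjective 2 (fiberOver π t) := hπ.isSmoothProjective t
  haveI := finite hXt 2
  -- ### instances for Ehresmann (rational transports)
  haveI := hπ.smoothOfRelativeDimension
  haveI := hπ.isProper
  haveI : LocallyOfFiniteType S.hom := hS.locallyOfFiniteType
  haveI : IsSeparated S.hom := hS.isVarietyPair_ofScheme.isSeparated
  haveI : QuasiCompact S.hom := hS.isVarietyPair_ofScheme.quasiCompact
  haveI : CompactSpace S.left := QuasiCompact.compactSpace_of_compactSpace S.hom
  have hrat : ∀ (s s' : (Set.univ : Set (ComplexPoints S))) (γ : Path.Homotopic.Quotient s s')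
      (α : complexBetti (fiberOver π s.1) 2), IsRationalClass α → IsRationalClass (transportFun π 2 hU γ α) :=
    fun s s' γ α hα => isRationalClass_transportFun_univ (f := π) (k := 2) 2 d γ hα
  -- ### `A² ∈ End_Hdg`, so `ker(A² − 1) ≤ Hdg¹`
  set A := pull (fiberOverEnd π τ hτ t) 2 with hA
  have hA2 : A ^ 2 ∈ (hodge exists_isReal_hodgeModel_holds hXt 2).endAlg := by
    have h := (pullHodgeHom exists_isReal_hodgeModel_holds hodgePQ_independent_of_hodgeModel_holds hXt hXt
      (fiberOverEnd π τ hτ t) 2).toLinearMap_mem_endAlg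
    rw [pullHodgeHom_toLinearMap] at h
    exact Subalgebra.pow_mem _ h 2
  have hHdg : Module.End.eigenspace (A ^ 2) 1 ≤ (hodge exists_isReal_hodgeModel_holds hXt 2).hodgeClasses 1 :=
    eigenspace_one_le_hodgeClasses_one hXt hA2 h20
  -- monodromy preserves `ker(A² − 1)`
  have hΓA2 : ∀ γ ∈ ratMonodromyGroup π 2 hU ⟨t, Set.mem_univ t⟩, ∀ x, γ ((A ^ 2) x) = (A ^ 2) (γ x) := fun γ hγ x => by
    rw [pow_two, Module.End.mul_apply, Module.End.mul_apply, hΓA γ hγ, hΓA γ hγ]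
  -- ### every monodromy translate of `v ⊗ 1` is a rational `(1,1)`-class
  set α : complexBetti (fiberOver π t) 2 := ofRatClass _ 2 v with hαdef
  have hα : ∀ (γ : Path t t) ⦃β : complexBetti (fiberOver π t) 2⦄, IsContinuationAlong γ α β →
      IsRationalClass β ∧ IsOfHodgeType 2 (fiberOver π t) 2 1 1 β := by
    intro γ β hβ
    rw [isContinuationAlong_iff_transportFun_eq π 2 hU] at hβ
    subst hβ
    obtain ⟨T, hT⟩ := exists_ratTransport π 2 hU hrat
      (s := ⟨t, Set.mem_univ t⟩) (t := ⟨t, Set.mem_univ t⟩) ⟦γ.map (continuous_id.subtype_mk fun x ↦ Set.mem_univ x)⟧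
    have hTmem : T ∈ ratMonodromyGroup π 2 hU ⟨t, Set.mem_univ t⟩ := ⟨_, hT⟩
    have hTv : T v ∈ Module.End.eigenspace (A ^ 2) 1 :=
      apply_mem_eigenspace_of_comm (f := A ^ 2) (g := (T : bettiCohomology (fiberOver π t) 2 →ₗ[ℚ] _)) (hΓA2 T hTmem) hv
    rw [hαdef, ← hT v]
    exact ⟨isRationalClass_ofRatClass _,
      HodgeModel.isOfHodgeType_of_mem_hodgeClasses (realHodgeModel exists_isReal_hodgeModel_holds hXt) hXt
        (realHodgeModel_isHodgeSymmetric exists_isReal_hodgeModel_holds hXt) (p := 1) (hHdg hTv)⟩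
  -- ### Deligne's move (F): a finite-index subgroup of `π₁` fixes `α`
  obtain ⟨Hs, hHfi, hHfix⟩ := exists_finiteIndex_of_isOfHodgeType π d hπ h𝒳 hS t hU (p := 1) α hα
  -- ### its image in the monodromy group
  let ρ := ratMonodromyRep π 2 hU hrat ⟨t, Set.mem_univ t⟩
  have hrange : ρ.range = ratMonodromyGroup π 2 hU ⟨t, Set.mem_univ t⟩ := range_ratMonodromyRep π 2 hU hrat _
  refine ⟨Hs.map ρ, (Subgroup.map_le_range ρ Hs).trans hrange.le, ?_, ?_⟩
  · -- finite index: along the surjection `ρ : π₁ → Γ_t`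
    rw [← hrange]
    have hsurj : Function.Surjective ρ.rangeRestrict := MonoidHom.rangeRestrict_surjective ρ
    have heq : (Hs.map ρ).subgroupOf ρ.range = Hs.map ρ.rangeRestrict := by
      ext x
      rw [Subgroup.mem_subgroupOf, Subgroup.mem_map, Subgroup.mem_map]
      constructor
      · rintro ⟨γ, hγ, hγx⟩
        exact ⟨γ, hγ, Subtype.ext hγx⟩
      · rintro ⟨γ, hγ, hγx⟩
        exact ⟨γ, hγ, congrArg Subtype.val hγx⟩
    rw [heq]
    exact ⟨ne_zero_of_dvd_ne_zero hHfi.index_ne_zero (Subgroup.index_map_dvd _ hsurj)⟩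
  · -- fixes `v`: `(ρ γ v) ⊗ 1 = γ_* (v ⊗ 1) = v ⊗ 1`
    rintro _ ⟨γ, hγ, rfl⟩
    apply ofRatClass_injective
    exact (ofRatClass_ratMonodromyRep_apply π 2 hU hrat ⟨t, Set.mem_univ t⟩ γ v).trans (hHfix γ hγ)

end Summit.HodgeConjecture.HodgeConjecture.Theorems.Q8SymplecticPowersInvariantPartFiniteOrbit

end
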